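import Literature.MathematicalPhysics.KineticTheory.HardSphereHierarchyModel
import Literature.MathematicalPhysics.KineticTheory.Sweep1EmpiricalProofs
import HarnessLib

/-!
# The evolved correlation functions do not depend on the hard-sphere flows, almost everywhere
# (Lanford's theorem, the BBGKY side: reduction to the regularised Alexander flows)

(Topic MathematicalPhysics/KineticTheory; layer L2a of the bottom-up proof plan of the named fact
`Literature.MathematicalPhysics.KineticTheory.lanford` — **hilbert6.S02**, Lanford's theorem for hard
spheres on `T^d`, `Literature/MathematicalPhysics/KineticTheory/Sweep1.lean`. Theorems only: no
definition, no named fact.)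

The statement of `lanford` quantifies over ALL families of hard-sphere flows `Φ k N`
(`Kinetic.HardSphereFlow`: Alexander's theorem as data, each with its own conull good set), and its
conclusion concerns the rescaled correlation functions of the evolved grand-canonical state
`gcEvolved (Φ k) W₀ t` (`Kinetic.correlationFn`; `TendstoCorrelations` asks for versions, i.e. it is
an almost-everywhere statement). By forward uniqueness of hard-sphere trajectories two hard-sphere
flows of the same system agree Liouville-almost everywhere at every time
(`HardSphereFlow.flow_eq_ae_holds`, GST 2013 Prop. 4.1.1; hence
`indicator_hsTransport_ae_eq_of_flows` of `HardSphereHierarchyModel`), so every sector of the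
evolved state, every marginal of it (Fubini) and therefore every correlation function is
independent of the flows up to null sets:

* `marginal_ae_eq_of_ae_eq`, `correlationFn_ae_eq_of_ae_eq` — marginals and rescaled correlation
  functions of almost-everywhere equal states agree almost everywhere (Fubini along
  `Config (s + p) ≃ Config s × Config p`, countably many sectors);
* `gcEvolved_ae_eq_of_flows`, `correlationFn_gcEvolved_ae_eq_of_flows` — **the evolved state and
  its correlation functions along two families of hard-sphere flows agree a.e.**;
* `ae_eq_correlationFn_gcEvolved_of_regularised` — consequently the representation clause of the
  hypothesis of `lanford_of_bbgkySide` (`LanfordAssembly`: versions of the evolved correlation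
  functions given by a series `∑_n A_n`) need only be proved along ONE family of flows, e.g. the
  regularised Alexander flows `Alexander.regHardSphereFlow` used by the grand-canonical hierarchy
  model `gcHierarchyModel` of `LanfordGCHierarchy` (the same reduction as
  `bgsrTaggedMarginal_ae_eq_of_flows` in the BGSR programme).

## References

* I. Gallagher, L. Saint-Raymond, B. Texier, *From Newton to Boltzmann: hard spheres and short-range
  potentials*, EMS ZLAM (2013) = arXiv:1208.5753 (held text), Prop. 4.1.1 (p. 19: the hard-sphere
  flow is well defined and unique away from a Liouville-null set), (4.3.2) (marginals) (bib key
  `GST2013`).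
* C. Cercignani, R. Illner, M. Pulvirenti, *The Mathematical Theory of Dilute Gases*, Springer
  (1994), §4.2 Thm 4.2.1 (existence and uniqueness of the hard-sphere flow a.e.), App. 4.A (bib key
  `CIP1994`).
-/

open MeasureTheory Set Filter Topology Function
open scoped ENNReal Nat

namespace Literature.MathematicalPhysics.KineticTheory

noncomputable section

open Literature.Analysis.FluidPDE

variable {d : Type*} [Fintype d]

/-- **Marginals of almost-everywhere equal functions agree almost everywhere** (Fubini along the
measure-preserving juxtaposition `Config s × Config p ≃ Config (s + p)`, `exists_appendEquiv`).
[folklore] -/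
theorem marginal_ae_eq_of_ae_eq {s p : ℕ} {F G : Config (s + p) d (UnitAddTorus d) → ℝ}
    (h : F =ᵐ[volume] G) : marginal s p F =ᵐ[volume] marginal s p G := by
  haveI := sigmaFinite_volume_phaseSpace (d := d)
  obtain ⟨e, he, hmp⟩ := exists_appendEquiv s p (UnitAddTorus d × EuclideanSpace ℝ d)
  -- (the product `MeasureSpace` instance is taken from the statement of `exists_appendEquiv`:
  -- instance search does not find it on `Config s × Config p` directly)
  have hmp' : MeasurePreserving e
      ((volume : Measure (Config s d (UnitAddTorus d))).prod (volume : Measure (Config p d (UnitAddTorus d))))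
      volume := hmp
  have h' : ∀ᵐ q ∂((volume : Measure (Config s d (UnitAddTorus d))).prod
      (volume : Measure (Config p d (UnitAddTorus d)))), F (e q) = G (e q) := by
    have h2 : ∀ᵐ z ∂(Measure.map e ((volume : Measure (Config s d (UnitAddTorus d))).prod
        (volume : Measure (Config p d (UnitAddTorus d))))), F z = G z := by
      rw [hmp'.map_eq]
      exact h
    exact ae_of_ae_map e.measurable.aemeasurable h2
  filter_upwards [Measure.ae_ae_of_ae_prod h'] with Zs hZs
  simp only [marginal]
  refine integral_congr_ae ?_
  filter_upwards [hZs] with zp hzp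
  simpa only [he] using hzp

/-- **Rescaled correlation functions of almost-everywhere equal grand-canonical states agree
almost everywhere** (every sector a.e. equal ⇒ every marginal a.e. equal, countably many sectors).
[folklore] -/
theorem correlationFn_ae_eq_of_ae_eq (μ : ℝ) {W W' : GCState d (UnitAddTorus d)}
    (h : ∀ N, W N =ᵐ[volume] W' N) (s : ℕ) :
    correlationFn μ W s =ᵐ[volume] correlationFn μ W' s := by
  have hp : ∀ p : ℕ, marginal s p (W (s + p)) =ᵐ[volume] marginal s p (W' (s + p)) := fun p =>
    marginal_ae_eq_of_ae_eq (h (s + p))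
  have hall : ∀ᵐ Zs : Config s d (UnitAddTorus d),
      ∀ p : ℕ, marginal s p (W (s + p)) Zs = marginal s p (W' (s + p)) Zs := ae_all_iff.2 hp
  filter_upwards [hall] with Zs hZs
  simp only [correlationFn, hZs]

variable {ε : ℝ}

/-- **The evolved grand-canonical state along two families of hard-sphere flows agrees almost
everywhere**, sector by sector (`indicator_hsTransport_ae_eq_of_flows`: two hard-sphere flows of
the same system agree Liouville-a.e., GST 2013 Prop. 4.1.1, and both transports vanish off the
good sets). [cite: GST2013, Prop. 4.1.1 p. 19] -/
theorem gcEvolved_ae_eq_of_flows (Φ Ψ : (N : ℕ) → HardSphereFlow (Torus.geometry d) ε N)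
    (W : GCState d (UnitAddTorus d)) (t : ℝ) (N : ℕ) :
    gcEvolved Φ W t N =ᵐ[volume] gcEvolved Ψ W t N :=
  indicator_hsTransport_ae_eq_of_flows (Φ N) (Ψ N) t (W N)

/-- **The evolved rescaled correlation functions do not depend on the hard-sphere flows, almost
everywhere**: for any two families `Φ`, `Ψ` of hard-sphere flows on `T^d` (diameter `ε`), every
activity `μ`, initial state `W`, time `t` and level `s`,
`correlationFn μ (gcEvolved Φ W t) s = correlationFn μ (gcEvolved Ψ W t) s` a.e.
[cite: GST2013, Prop. 4.1.1 p. 19] -/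
theorem correlationFn_gcEvolved_ae_eq_of_flows (Φ Ψ : (N : ℕ) → HardSphereFlow (Torus.geometry d) ε N)
    (μ : ℝ) (W : GCState d (UnitAddTorus d)) (t : ℝ) (s : ℕ) :
    correlationFn μ (gcEvolved Φ W t) s =ᵐ[volume] correlationFn μ (gcEvolved Ψ W t) s :=
  correlationFn_ae_eq_of_ae_eq μ (fun N => gcEvolved_ae_eq_of_flows Φ Ψ W t N) s

/-- **Reduction of the representation clause of `lanford_of_bbgkySide` to the regularised flows.**
If a function `F` (e.g. the sum `∑_n Q^ε_{s,s+n}(t) F_ε(0)` of the Duhamel series of the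
grand-canonical hierarchy, `lanfordGCTerm`) is a version of the level-`s` correlation function of
the state evolved along the regularised Alexander flows `Alexander.regHardSphereFlow hε hε'`
(`0 < ε < 1/2`), then it is a version of the level-`s` correlation function of the state evolved
along ANY family of hard-sphere flows `Φ`. [cite: GST2013, Prop. 4.1.1 p. 19] -/
theorem ae_eq_correlationFn_gcEvolved_of_regularised (hε : 0 < ε) (hε' : ε < 2⁻¹) {μ : ℝ}
    {W : GCState d (UnitAddTorus d)} {t : ℝ} {s : ℕ} {F : Config s d (UnitAddTorus d) → ℝ}
    (hF : F =ᵐ[volume]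
      correlationFn μ (gcEvolved (fun N => Alexander.regHardSphereFlow (d := d) hε hε' N) W t) s)
    (Φ : (N : ℕ) → HardSphereFlow (Torus.geometry d) ε N) :
    F =ᵐ[volume] correlationFn μ (gcEvolved Φ W t) s :=
  hF.trans (correlationFn_gcEvolved_ae_eq_of_flows _ Φ μ W t s)

end

end Literature.MathematicalPhysics.KineticTheory
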